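import Summits.Parity.GeneralizedHardyLittlewood.Theorems.PrimeLevelFamEdgeMomentsBeyondDiagonalFirstOrderDiagOrder
import Summits.Parity.GeneralizedHardyLittlewood.Theorems.PrimeLevelFamEdgeMomentsBeyondDiagonalFirstOrderMollifiedK
import HarnessLib

/-!
# The order-`j` mollified first moment beyond the diagonal: main term `ζ(2) q̂^{1/2} ℓ^{j−1}(P′(1)/Δ' + jP(1))`
# (helper for crux K_A `PrimeLevelFamEdge.MomentsBeyondDiagonal`, stmt-Parity-20007, stub `stub_first : SubFirst` ∀`Q`)

Triangle-inequality combination of `harmonicSum_derivLambda_mul_mollifierP_sub_complete_le` (mollified first moment at order `j` =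
complete diagonal + off-diagonal error) and `diagOrder_mul_sq_log_sub_le` (complete diagonal at `M = q̂^{Δ'}`): for `N` prime,
`P` admissible with `|P| ≤ B` on `[0,1]`, `Δ' > 0`, `j`, and `q̂` with `log q̂ ≥ 1`, `3 ≤ q̂^{Δ'} ≤ N` (`ℓ = log q̂`):
`‖ℓ² Σʰ_f Λ^{(j)}(f,½) M_P(f) − q̂^{1/2}(π²/6)ℓ^{j+1}(P′(1)/Δ' + jP(1))‖ ≤ C₁(1+log N)^{j+4} q̂^{1/2} B q̂^{Δ'} ℓ²/N + C₂ q̂^{1/2} ℓ^j`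
(`orderJ_mul_sq_log_sub_le`). For `1 < Δ' < 2` the first error is `q̂^{1/2}·O(q̂^{Δ'−2} polylog)`; dividing by `ℓ^{j+2}` this is
KMV's first display at `Q = Y^j` with NO extra main term (`T₁ = 0`). What remains for `stub_first` ∀`Q`: absorb the power saving into
`ℓ^{−2}`, sum over the orders `j` with `Q_j ℓ^{−j}` (`LhPQ_eq_sum_orders`), and package `SubFirst` (Δ = 3/2, T₁ = 0).
Proof only; nothing about Landau–Siegel zeros; K_A NOT proved.
-/

noncomputable section

open scoped Real
open Set MeasureTheory Finset Polynomial
open Literature.NumberTheory.EllipticCurves.ModularForms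
open Literature.NumberTheory.LFunctions Literature.NumberTheory.LFunctions.KMV2000

namespace Summit.Parity.GeneralizedHardyLittlewood.Theorems.MomentsBeyondDiagonal.FirstOrderAFE

set_option maxHeartbeats 400000 in
/-- **Order-`j` mollified first moment, main term** (`N` prime, `P` admissible, `|P| ≤ B` on `[0,1]`, `Δ' > 0`, `log q̂ ≥ 1`,
`3 ≤ q̂^{Δ'} ≤ N`): `‖ℓ² Σʰ Λ^{(j)} M_P − q̂^{1/2}(π²/6)ℓ^{j+1}(P′(1)/Δ' + jP(1))‖ ≤ C₁(1+log N)^{j+4}q̂^{1/2}B q̂^{Δ'}ℓ²/N + C₂ q̂^{1/2}ℓ^j`.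
[cite: KowalskiMichelVanderKam2000, Prop. 4.1, §4.1 (19)–(20), §6 (30)] [cite: Bettin2017, Thm. 1.1] -/
theorem orderJ_mul_sq_log_sub_le {P : ℝ[X]} (hP : Admissible P) {Δ' : ℝ} (hΔ : 0 < Δ') (j : ℕ) :
    ∃ C₁ C₂ : ℝ, 0 ≤ C₁ ∧ 0 ≤ C₂ ∧ ∀ (N : ℕ) [NeZero N], N.Prime → ∀ B : ℝ, (∀ t ∈ Set.Icc (0 : ℝ) 1, |P.eval t| ≤ B) →
      1 ≤ Real.log (KMV2000.qhat N) → 3 ≤ KMV2000.qhat N ^ Δ' → KMV2000.qhat N ^ Δ' ≤ N →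
      ‖(((Real.log (KMV2000.qhat N)) ^ 2 : ℝ) : ℂ) *
            GL2Family.harmonicSum N 2 (fun f ↦ derivLambda N j f * mollifierP N P (KMV2000.qhat N ^ Δ') f) -
          ((KMV2000.qhat N : ℝ) : ℂ) ^ (1 / 2 : ℂ) *
            ((π ^ 2 / 6 * Real.log (KMV2000.qhat N) ^ (j + 1) * ((derivative P).eval 1 / Δ' + (j : ℝ) * P.eval 1) : ℝ) : ℂ)‖ ≤
        C₁ * (1 + Real.log N) ^ (j + 4) * Real.sqrt (KMV2000.qhat N) * B * KMV2000.qhat N ^ Δ' *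
            Real.log (KMV2000.qhat N) ^ 2 / N +
          C₂ * Real.sqrt (KMV2000.qhat N) * Real.log (KMV2000.qhat N) ^ j := by
  obtain ⟨C₁, hC₁0, h₁⟩ := harmonicSum_derivLambda_mul_mollifierP_sub_complete_le j
  obtain ⟨C₂, h₂⟩ := diagOrder_mul_sq_log_sub_le hP hΔ j
  have hC₂0 : 0 ≤ max C₂ 0 := le_max_right _ _
  refine ⟨C₁, max C₂ 0, hC₁0, hC₂0, fun N _ hN B hB hℓ hM3 hMN ↦ ?_⟩
  have hq := qhat_pos_of_neZero N
  set qh : ℝ := KMV2000.qhat N with hqh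
  set ℓ : ℝ := Real.log qh with hℓdef
  have hℓ0 : 0 < ℓ := by linarith
  set M : ℝ := qh ^ Δ' with hMdef
  have hM1 : 1 < M := by linarith
  have hS := h₁ N hN P B hB M hM1 hMN
  have hD := (h₂ qh hq hℓ hM3).trans (mul_le_mul_of_nonneg_right (le_max_left C₂ 0) (pow_nonneg hℓ0.le j))
  -- the complex diagonal sum is the real one
  set D : ℝ := ∑ m ∈ Finset.Icc 1 ⌊M⌋₊, mollifierCoeff P M m * (m : ℝ) ^ (-(1 / 2 : ℝ)) *
    (∫ x in Ioi (0 : ℝ), Real.exp (-x) * (Real.log (qh / m) + Real.log x) ^ j) with hDdef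
  have hDC : ∑ m ∈ Finset.Icc 1 ⌊M⌋₊, (mollifierCoeff P M m : ℂ) * (((m : ℝ) ^ (-(1 / 2 : ℝ)) : ℝ) : ℂ) *
      ((∫ x in Ioi 0, Real.exp (-x) * (Real.log (qh / m) + Real.log x) ^ j : ℝ) : ℂ) = ((D : ℝ) : ℂ) := by
    rw [hDdef]; push_cast; rfl
  rw [hDC] at hS
  have hnq : ‖(qh : ℂ) ^ (1 / 2 : ℂ)‖ = Real.sqrt qh := by
    rw [Complex.norm_cpow_eq_rpow_re_of_pos hq, Real.sqrt_eq_rpow]; norm_num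
  -- triangle inequality
  set S := GL2Family.harmonicSum N 2 (fun f ↦ derivLambda N j f * mollifierP N P M f) with hSdef
  set mainR : ℝ := π ^ 2 / 6 * ℓ ^ (j + 1) * ((derivative P).eval 1 / Δ' + (j : ℝ) * P.eval 1) with hmainR
  have hkey : ((ℓ ^ 2 : ℝ) : ℂ) * S - (qh : ℂ) ^ (1 / 2 : ℂ) * (mainR : ℂ) =
      ((ℓ ^ 2 : ℝ) : ℂ) * (S - (qh : ℂ) ^ (1 / 2 : ℂ) * (D : ℂ)) + (qh : ℂ) ^ (1 / 2 : ℂ) * (((ℓ ^ 2 * D - mainR : ℝ)) : ℂ) := by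
    push_cast; ring
  rw [hkey]
  have hA : ‖((ℓ ^ 2 : ℝ) : ℂ) * (S - (qh : ℂ) ^ (1 / 2 : ℂ) * (D : ℂ))‖ ≤
      ℓ ^ 2 * (C₁ * (1 + Real.log N) ^ (j + 4) * Real.sqrt qh * B * M / N) := by
    rw [norm_mul, Complex.norm_real, Real.norm_of_nonneg (by positivity)]
    exact mul_le_mul_of_nonneg_left hS (by positivity)
  have hB' : ‖(qh : ℂ) ^ (1 / 2 : ℂ) * (((ℓ ^ 2 * D - mainR : ℝ)) : ℂ)‖ ≤ Real.sqrt qh * (max C₂ 0 * ℓ ^ j) := by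
    rw [norm_mul, hnq, Complex.norm_real, Real.norm_eq_abs]
    exact mul_le_mul_of_nonneg_left hD (Real.sqrt_nonneg _)
  calc _ ≤ ℓ ^ 2 * (C₁ * (1 + Real.log N) ^ (j + 4) * Real.sqrt qh * B * M / N) + Real.sqrt qh * (max C₂ 0 * ℓ ^ j) :=
        (norm_add_le _ _).trans (add_le_add hA hB')
    _ = C₁ * (1 + Real.log N) ^ (j + 4) * Real.sqrt qh * B * M * ℓ ^ 2 / N + max C₂ 0 * Real.sqrt qh * ℓ ^ j := by ring

end Summit.Parity.GeneralizedHardyLittlewood.Theorems.MomentsBeyondDiagonal.FirstOrderAFE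

end
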